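import Mathlib
import HarnessLib
import Literature.AlgebraicGeometry.Morphisms.CechH1LocalVanishing
import Literature.AlgebraicGeometry.Morphisms.CechH1Leray
import Literature.AlgebraicGeometry.Resolution.AlterationsResolution
import Literature.AlgebraicGeometry.Morphisms.SteinFactorizationProofs
import Summits.ResolutionOfSingularities.ResolutionOfSingularities.Theorems.HomologicalConductorSurfaceTerminationGenusLocalResolution

/-!
# Kill test `SurfaceTermination` (stmt-ResolutionOfSingularities-16488), W4.4 support programme
# «P_G LERAY» (U2c, part 2): `Ȟ¹` vanishes chartwise along a domination of regular surfaces, and the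
# geometric genus does not grow under domination

Route `ResolutionOfSingularities/HomologicalConductor`, crux chain W4.4; SUPPORT-level (kill test
`SurfaceTermination`), NOT crux 19943. OURS (cell res-hironaka; res-D-pv-045, PG-LERAY-NOTE block (L3);
tri-1 TRIAGE v6.2 (5a) «genus_resolution_independent»); AI-written, weaker than expert review; nothing of
the manuscript under review (Hironaka 2017) is used.

For `ρ : Z → X` proper birational between regular schemes (`X` integral with local rings of dimension
`≤ 2`, e.g. two resolutions of a normal surface germ, `Z` dominating `X`):
* `cechZ1_le_cechB1_of_forall_stalk` — flexible local-to-global criterion: `Ȟ¹(𝒢, 𝒪) = 0` on an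
  `A`-scheme as soon as it vanishes after base change along SOME localisation datum at every maximal ideal
  (any `IsLocalization`/`IsPullback` presentation; cf. `CechLocalization.cechZ1_le_cechB1_of_forall_maximal`);
* `cechZ1_le_cechB1_chart` — for an affine open `U ⊆ X` and a finite family `𝒢` of affine opens of `Z`
  covering `ρ⁻¹U` (affine pairwise/triple intersections), `Ȟ¹(𝒢, 𝒪_Z) = 0`: chartwise `R¹ρ_*𝒪_Z = 0`
  (pointwise input `hasTrivialCechH1_pullback_snd_fromSpecStalk`, mod `Lipman1969_1_2`);
* `cechRefineH1_comp_cechComapH1_surjective`, `length_cechH1_le_of_dominates` — the composite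
  `Ȟ¹(𝒰, 𝒪_X) → Ȟ¹(ρ⁻¹𝒰, 𝒪_Z) → Ȟ¹(𝒲, 𝒪_Z)` is surjective for a finite affine cover `𝒰` of `X` and a
  finite affine cover `𝒲` of `Z` refining `ρ⁻¹𝒰`, hence
  `length_T Ȟ¹(𝒲, 𝒪_Z) ≤ length_T Ȟ¹(𝒰, 𝒪_X)` over any base ring `T` (resolution-independence /
  monotonicity of the geometric genus under domination).

References: J. Lipman, Publ. IHÉS 36 (1969), Prop. (1.2) and p. 200 A)/B) [`Lipman1969`]; M. Artin,
«Lipman's proof of resolution of singularities for surfaces», in Cornell–Silverman (1986), Prop. (3.2)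
[`Artin1986Lipman`, context]; U. Görtz, T. Wedhorn II, Cor. 21.82 [`GortzWedhorn2023`].
-/

noncomputable section
set_option linter.dupNamespace false

namespace Summit.ResolutionOfSingularities.ResolutionOfSingularities.Theorems.SurfaceTermination.GenusDescent

open CategoryTheory CategoryTheory.Limits AlgebraicGeometry TopologicalSpace IsLocalRing
open Literature.AlgebraicGeometry.Resolution Literature.AlgebraicGeometry.Morphisms
open Literature.AlgebraicGeometry.Morphisms.CechLocalization

/-! ## Structure-map independence and transport of the vanishing `Ž¹ ≤ B̌¹` -/

section Transport

variable {A B : Type} [CommRing A] [CommRing B] {X Y : Scheme.{0}}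

/-- `Ž¹ ⊆ B̌¹` does not depend on the base ring through which the Čech groups are regarded as
modules (the cochain maps are the same functions). [folklore] -/
theorem cechZ1_le_cechB1_iff_of_base (f : X ⟶ Spec (.of A)) (f' : X ⟶ Spec (.of B)) {ι : Type}
    (U : ι → X.Opens) : cechZ1 f U ≤ cechB1 f U ↔ cechZ1 f' U ≤ cechB1 f' U := by
  constructor <;> intro h c hc
  · obtain ⟨b, hb⟩ := (mem_cechB1_iff f U c).mp (h ((mem_cechZ1_iff f U c).mpr
      ((mem_cechZ1_iff f' U c).mp hc)))
    exact (mem_cechB1_iff f' U c).mpr ⟨b, hb⟩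
  · obtain ⟨b, hb⟩ := (mem_cechB1_iff f' U c).mp (h ((mem_cechZ1_iff f' U c).mpr
      ((mem_cechZ1_iff f U c).mp hc)))
    exact (mem_cechB1_iff f U c).mpr ⟨b, hb⟩

/-- A subsingleton `Ȟ¹` means `Ž¹ ⊆ B̌¹`. [folklore] -/
theorem cechZ1_le_cechB1_of_subsingleton (f : X ⟶ Spec (.of A)) {ι : Type} (U : ι → X.Opens)
    (h : Subsingleton (CechH1 f U)) : cechZ1 f U ≤ cechB1 f U := fun c hc =>
  (CechH1.mk_eq_zero_iff f U ⟨c, hc⟩).mp (Subsingleton.elim _ _)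

/-- **Transport of `Ž¹ ⊆ B̌¹` backwards along a morphism whose section maps are bijective** (e.g. an
open immersion and a family of opens inside its range): if `Ȟ¹(g⁻¹𝒢, 𝒪_Y) = 0` then `Ȟ¹(𝒢, 𝒪_X) = 0`.
[cite: StacksProject, Tag 01ED] -/
theorem cechZ1_le_cechB1_of_comap (fX : X ⟶ Spec (.of A)) (fY : Y ⟶ Spec (.of A)) (g : Y ⟶ X)
    (hg : g ≫ fX = fY) {ι : Type} (U : ι → X.Opens)
    (h0 : ∀ i, Function.Surjective (Sections.comap fX fY g hg (le_refl (g ⁻¹ᵁ U i))))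
    (h1 : ∀ i j, Function.Injective (Sections.comap fX fY g hg
      (show g ⁻¹ᵁ U i ⊓ g ⁻¹ᵁ U j ≤ g ⁻¹ᵁ (U i ⊓ U j) from fun _ hx => hx)))
    (h : cechZ1 fY (preimageFamily g U) ≤ cechB1 fY (preimageFamily g U)) :
    cechZ1 fX U ≤ cechB1 fX U := by
  intro c hc
  obtain ⟨b', hb'⟩ := (mem_cechB1_iff fY _ _).mp (h (comapC1_mem_cechZ1 fX fY g hg U hc))
  choose b hb using fun i => h0 i (b' i)
  refine (mem_cechB1_iff fX U c).mpr ⟨b, ?_⟩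
  ext i j
  apply h1 i j
  have e := congrFun (congrFun (cechD0_comapC0 fX fY g hg U b) i) j
  have hbb : cechComapC0 fX fY g hg U b = b' := by
    ext i; exact hb i
  rw [hbb, hb'] at e
  rw [cechComapC1_apply] at e
  exact e.symm

end Transport

/-! ## Flexible local-to-global vanishing -/

section LocalGlobal

variable {A : Type} [CommRing A] {X : Scheme.{0}} (f : X ⟶ Spec (.of A)) {ι : Type} [Finite ι]
  (U : ι → X.Opens)

/-- **`Ȟ¹(𝒰, 𝒪_X) = 0` if it vanishes after base change along SOME localisation datum at every maximal
ideal**: for each maximal `𝔪`, a ring `A'` with `IsLocalization 𝔪.primeCompl A'`, a cartesian square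
`Y = X ×_A Spec A'` (any presentation) and the vanishing on `Y`. (Flexible form of
`CechLocalization.cechZ1_le_cechB1_of_forall_maximal`.) [cite: EGAIII1, Prop. (1.4.15)] -/
theorem cechZ1_le_cechB1_of_forall_stalk (hU : ∀ i, IsAffineOpen (U i))
    (hU2 : ∀ i j, IsAffineOpen (U i ⊓ U j)) (hU3 : ∀ i j k, IsAffineOpen (U i ⊓ U j ⊓ U k))
    (h : ∀ (𝔪 : Ideal A) [𝔪.IsMaximal], ∃ (A' : Type) (_ : CommRing A') (_ : Algebra A A')
      (_ : IsLocalization 𝔪.primeCompl A') (Y : Scheme.{0}) (fY' : Y ⟶ Spec (.of A')) (g : Y ⟶ X)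
      (_ : IsPullback g fY' f (Spec.map (CommRingCat.ofHom (algebraMap A A')))),
      cechZ1 (fY' ≫ Spec.map (CommRingCat.ofHom (algebraMap A A'))) (preimageFamily g U) ≤
        cechB1 (fY' ≫ Spec.map (CommRingCat.ofHom (algebraMap A A'))) (preimageFamily g U)) :
    cechZ1 f U ≤ cechB1 f U := by
  intro z hz
  set c : CechH1 f U := CechH1.mk f U ⟨z, hz⟩ with hc
  suffices hc0 : c = 0 by exact (CechH1.mk_eq_zero_iff f U ⟨z, hz⟩).mp hc0
  have hkill : ∀ (𝔪 : Ideal A) [𝔪.IsMaximal], ∃ s : A, s ∉ 𝔪 ∧ s • c = 0 := by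
    intro 𝔪 _
    obtain ⟨A', _, _, _, Y, fY', g, H, hv⟩ := h 𝔪
    haveI hloc := isLocalizedModule_cechComapH1 𝔪.primeCompl f fY'
      (fY' ≫ Spec.map (CommRingCat.ofHom (algebraMap A A'))) g rfl H U hU hU2 hU3
    have himg : cechComapH1 f (fY' ≫ Spec.map (CommRingCat.ofHom (algebraMap A A'))) g H.w U c =
        0 := by
      rw [hc, cechComapH1_mk, CechH1.mk_eq_zero_iff, cechComapZ1_coe]
      exact hv (comapC1_mem_cechZ1 f _ _ _ U hz)
    obtain ⟨s, hs⟩ := (IsLocalizedModule.eq_zero_iff 𝔪.primeCompl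
      (cechComapH1 f (fY' ≫ Spec.map (CommRingCat.ofHom (algebraMap A A'))) g H.w U)).mp himg
    exact ⟨s, s.2, hs⟩
  by_contra hne
  let I : Ideal A := (LinearMap.toSpanSingleton A (CechH1 f U) c).ker
  have hI : I ≠ ⊤ := by
    intro hI
    have h1 : (1 : A) ∈ I := hI ▸ Submodule.mem_top
    have : (1 : A) • c = 0 := h1
    exact hne (by simpa using this)
  obtain ⟨𝔪, h𝔪, hI𝔪⟩ := Ideal.exists_le_maximal I hI
  obtain ⟨s, hs𝔪, hsc⟩ := hkill 𝔪
  exact hs𝔪 (hI𝔪 (show s ∈ I from hsc))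

end LocalGlobal

/-! ## Chartwise vanishing of `Ȟ¹` along a domination of regular surfaces -/

section Chart

variable {T : Type} [CommRing T] {X Z : Scheme.{0}} [IsIntegral X] [NoetherianSpace X]
  [NoetherianSpace Z] (πX : X ⟶ Spec (.of T)) (ρ : Z ⟶ X) [IsProper ρ]

/-- **Chartwise `R¹ρ_*𝒪_Z = 0`**: for `ρ : Z → X` proper birational with `Z` regular, `X` regular with local
rings of dimension `≤ 2`, an affine open `U ⊆ X`, and a finite family `𝒢` of affine opens of `Z` with
`⋃ 𝒢 = ρ⁻¹U` and affine pairwise and triple intersections: `Ȟ¹(𝒢, 𝒪_Z) = 0` (mod Lipman (1.2)).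
[cite: Lipman1969, Proposition (1.2) 2) (p. 199)] -/
theorem cechZ1_le_cechB1_chart (h12 : Lipman1969_1_2.{0}) (hρ : IsBirational ρ)
    (hZ : Scheme.IsRegular Z) (hX : Scheme.IsRegular X)
    (hdimX : ∀ x : X, ringKrullDim (X.presheaf.stalk x) ≤ 2) {U : X.Opens} (hU : IsAffineOpen U)
    {κ : Type} [Finite κ] (G : κ → Z.Opens) (hGcov : ⨆ j, G j = ρ ⁻¹ᵁ U)
    (hG : ∀ j, IsAffineOpen (G j)) (hG2 : ∀ j j', IsAffineOpen (G j ⊓ G j'))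
    (hG3 : ∀ j j' j'', IsAffineOpen (G j ⊓ G j' ⊓ G j'')) :
    cechZ1 (ρ ≫ πX) G ≤ cechB1 (ρ ≫ πX) G := by
  classical
  have hGle : ∀ j, G j ≤ ρ ⁻¹ᵁ U := fun j => hGcov ▸ le_iSup G j
  -- (A) transport to the chart `ρ⁻¹U` along the open immersion `ι = (ρ⁻¹U).ι`
  have hbij : ∀ V : Z.Opens, V ≤ ρ ⁻¹ᵁ U →
      Function.Bijective (Sections.comap (ρ ≫ πX) ((ρ ⁻¹ᵁ U).ι ≫ ρ ≫ πX) (ρ ⁻¹ᵁ U).ι rfl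
        (le_refl ((ρ ⁻¹ᵁ U).ι ⁻¹ᵁ V))) := by
    intro V hV
    have hVr : V ≤ (ρ ⁻¹ᵁ U).ι.opensRange := by rwa [Scheme.Opens.opensRange_ι]
    haveI := (ρ ⁻¹ᵁ U).ι.isIso_app V hVr
    rw [show (Sections.comap (ρ ≫ πX) ((ρ ⁻¹ᵁ U).ι ≫ ρ ≫ πX) (ρ ⁻¹ᵁ U).ι rfl
        (le_refl ((ρ ⁻¹ᵁ U).ι ⁻¹ᵁ V)) : _ → _) = ((ρ ⁻¹ᵁ U).ι.app V).hom from by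
      funext s; rw [Sections.comap_apply, Scheme.Hom.appLE_eq_app]]
    exact ConcreteCategory.bijective_of_isIso ((ρ ⁻¹ᵁ U).ι.app V)
  refine cechZ1_le_cechB1_of_comap (ρ ≫ πX) ((ρ ⁻¹ᵁ U).ι ≫ ρ ≫ πX) (ρ ⁻¹ᵁ U).ι rfl G
    (fun j => (hbij (G j) (hGle j)).2)
    (fun j j' => (hbij (G j ⊓ G j') (inf_le_left.trans (hGle j))).1) ?_
  -- (B) regard the chart as a `Γ(X, U)`-scheme via `ρ ∣_ U`
  rw [cechZ1_le_cechB1_iff_of_base ((ρ ⁻¹ᵁ U).ι ≫ ρ ≫ πX) ((ρ ∣_ U) ≫ hU.isoSpec.hom)]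
  have haffι : ∀ V : Z.Opens, V ≤ ρ ⁻¹ᵁ U → IsAffineOpen V →
      IsAffineOpen ((ρ ⁻¹ᵁ U).ι ⁻¹ᵁ V) := by
    intro V hV hVa
    rw [← (ρ ⁻¹ᵁ U).ι.isAffineOpen_iff_of_isOpenImmersion,
      Scheme.Hom.image_preimage_eq_opensRange_inf, Scheme.Opens.opensRange_ι, inf_eq_right.mpr hV]
    exact hVa
  have hG' : ∀ j, IsAffineOpen (preimageFamily (ρ ⁻¹ᵁ U).ι G j) := fun j =>
    haffι (G j) (hGle j) (hG j)
  have hG2' : ∀ j j', IsAffineOpen (preimageFamily (ρ ⁻¹ᵁ U).ι G j ⊓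
      preimageFamily (ρ ⁻¹ᵁ U).ι G j') := fun j j' =>
    haffι (G j ⊓ G j') (inf_le_left.trans (hGle j)) (hG2 j j')
  have hG3' : ∀ j j' j'', IsAffineOpen (preimageFamily (ρ ⁻¹ᵁ U).ι G j ⊓
      preimageFamily (ρ ⁻¹ᵁ U).ι G j' ⊓ preimageFamily (ρ ⁻¹ᵁ U).ι G j'') := fun j j' j'' =>
    haffι (G j ⊓ G j' ⊓ G j'') ((inf_le_left.trans inf_le_left).trans (hGle j)) (hG3 j j' j'')
  refine cechZ1_le_cechB1_of_forall_stalk ((ρ ∣_ U) ≫ hU.isoSpec.hom) (preimageFamily (ρ ⁻¹ᵁ U).ι G)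
    hG' hG2' hG3' ?_
  -- (C) at a maximal ideal `𝔪 ↔ x ∈ U`: base change to `Spec 𝒪_{X,x}` and pointwise vanishing
  intro 𝔪 h𝔪
  let y : PrimeSpectrum Γ(X, U) := ⟨𝔪, h𝔪.isPrime⟩
  have hx : hU.fromSpec.base y ∈ U := by
    have h : hU.fromSpec.base y ∈ hU.fromSpec.opensRange := ⟨y, rfl⟩
    rwa [hU.opensRange_fromSpec] at h
  letI alg : Algebra Γ(X, U) (X.presheaf.stalk (hU.fromSpec.base y)) :=
    TopCat.Presheaf.algebra_section_stalk X.presheaf ⟨hU.fromSpec.base y, hx⟩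
  have hloc : IsLocalization.AtPrime (X.presheaf.stalk (hU.fromSpec.base y)) y.asIdeal :=
    hU.isLocalization_stalk' y hx
  have hgerm : CommRingCat.ofHom (algebraMap Γ(X, U) (X.presheaf.stalk (hU.fromSpec.base y))) =
      X.presheaf.germ U (hU.fromSpec.base y) hx := rfl
  -- right square: the chart over `Spec Γ(X, U) ≅ U ⊆ X`
  have t : IsPullback (ρ ⁻¹ᵁ U).ι ((ρ ∣_ U) ≫ hU.isoSpec.hom) ρ (hU.isoSpec.inv ≫ U.ι) :=
    (isPullback_morphismRestrict ρ U).flip.of_iso (Iso.refl _) (Iso.refl _) hU.isoSpec (Iso.refl _)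
      (by simp) (by simp) (by simp) (by simp)
  -- outer square: Mathlib's base change to `Spec 𝒪_{X,x}`
  have hφ : X.fromSpecStalk (hU.fromSpec.base y) =
      Spec.map (CommRingCat.ofHom (algebraMap Γ(X, U) (X.presheaf.stalk (hU.fromSpec.base y)))) ≫
        (hU.isoSpec.inv ≫ U.ι) := by
    rw [hgerm, hU.isoSpec_inv_ι, ← hU.fromSpecStalk_eq_fromSpecStalk hx]; rfl
  have s : IsPullback (pullback.fst ρ (X.fromSpecStalk (hU.fromSpec.base y)))
      (pullback.snd ρ (X.fromSpecStalk (hU.fromSpec.base y))) ρ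
      (Spec.map (CommRingCat.ofHom (algebraMap Γ(X, U) (X.presheaf.stalk (hU.fromSpec.base y)))) ≫
        (hU.isoSpec.inv ≫ U.ι)) :=
    (IsPullback.of_hasPullback ρ (X.fromSpecStalk (hU.fromSpec.base y))).of_iso (Iso.refl _)
      (Iso.refl _) (Iso.refl _) (Iso.refl _) (by simp only [Iso.refl_hom, Category.comp_id,
        Category.id_comp]) (by simp only [Iso.refl_hom, Category.comp_id, Category.id_comp])
      (by simp only [Iso.refl_hom, Category.comp_id, Category.id_comp])
      (by simp only [Iso.refl_hom, Category.comp_id, Category.id_comp]; exact hφ)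
  have H := IsPullback.of_right' s t
  refine ⟨X.presheaf.stalk (hU.fromSpec.base y), inferInstance, alg, hloc,
    pullback ρ (X.fromSpecStalk (hU.fromSpec.base y)),
    pullback.snd ρ (X.fromSpecStalk (hU.fromSpec.base y)), _, H, ?_⟩
  -- pointwise vanishing (`hasTrivialCechH1_pullback_snd_fromSpecStalk`) in the `𝒪_{X,x}`-structure
  rw [cechZ1_le_cechB1_iff_of_base _ (pullback.snd ρ (X.fromSpecStalk (hU.fromSpec.base y)))]
  apply cechZ1_le_cechB1_of_subsingleton
  have htriv := hasTrivialCechH1_pullback_snd_fromSpecStalk ρ (hU.fromSpec.base y) h12 hρ hZ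
    (hX _) (hdimX _)
  haveI : IsAffineHom (t.lift (pullback.fst ρ (X.fromSpecStalk (hU.fromSpec.base y)))
      (pullback.snd ρ (X.fromSpecStalk (hU.fromSpec.base y)) ≫
        Spec.map (CommRingCat.ofHom (algebraMap Γ(X, U) (X.presheaf.stalk (hU.fromSpec.base y)))))
      (by rw [s.w, Category.assoc])) :=
    isAffineHom_isStableUnderBaseChange.of_isPullback H.flip inferInstance
  refine htriv κ _ (fun j => (hG' j).preimage _) ?_
  change ⨆ j, _ ⁻¹ᵁ ((ρ ⁻¹ᵁ U).ι ⁻¹ᵁ G j) = ⊤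
  rw [← Scheme.Hom.preimage_iSup, ← Scheme.Hom.preimage_iSup, hGcov, Scheme.Opens.ι_preimage_self]
  rfl

end Chart


/-! ## Domination: `Ȟ¹(𝒰, 𝒪_X) ↠ Ȟ¹(𝒲, 𝒪_Z)` and the genus inequality -/

section Domination

variable {T : Type} [CommRing T] {X Z : Scheme.{0}} [IsIntegral X] [IsIntegral Z] [NoetherianSpace X]
  [NoetherianSpace Z] (πX : X ⟶ Spec (.of T)) (ρ : Z ⟶ X) [IsProper ρ]


-- The next three lemmas are adapted from
-- `Summits/HodgeConjecture/HodgeConjecture/Theorems/PadicSemiregularLiftFormalVectorBundlesAlgebraizeChowCoverNormal.lean`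
-- (namespace `FormalVectorBundlesAlgebraize`), copied to avoid a cross-summit import.

omit [IsIntegral X] [IsIntegral Z] [NoetherianSpace X] [NoetherianSpace Z] [IsProper ρ] in
/-- A surjective morphism between irreducible schemes maps the generic point to the generic point.
[folklore] -/
theorem apply_genericPoint_eq [IrreducibleSpace X] [IrreducibleSpace Z] [Surjective ρ] :
    ρ.base (genericPoint Z) = genericPoint X := by
  have h := (genericPoint_spec Z).image ρ.continuous
  rw [Set.image_univ_of_surjective ρ.surjective, closure_univ] at h
  exact h.eq (genericPoint_spec X)

omit [IsIntegral X] [IsIntegral Z] [NoetherianSpace X] [NoetherianSpace Z] [IsProper ρ] in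
/-- If `ρ` restricts to an isomorphism over the open `O ⊆ X`, its base change along any morphism
factoring through `O` is an isomorphism. [folklore] -/
theorem isIso_pullbackSnd_of_isIso_morphismRestrict (O : X.Opens) [IsIso (ρ ∣_ O)]
    {S : Scheme.{0}} (ψ : S ⟶ X) (g : S ⟶ O) (hψ : ψ = g ≫ O.ι) : IsIso (pullback.snd ρ ψ) := by
  subst hψ
  haveI : IsIso (pullback.snd ρ O.ι) := by
    rw [← pullbackRestrictIsoRestrict_hom_morphismRestrict]
    infer_instance
  haveI : IsIso ((pullbackLeftPullbackSndIso ρ O.ι g).hom ≫ pullback.snd ρ (g ≫ O.ι)) := by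
    rw [pullbackLeftPullbackSndIso_hom_snd]
    infer_instance
  exact IsIso.of_isIso_comp_left (pullbackLeftPullbackSndIso ρ O.ι g).hom _

omit [IsIntegral Z] [NoetherianSpace X] [NoetherianSpace Z] in
/-- **`ρ_*𝒪_Z = 𝒪_X`** for `ρ` proper surjective from an integral scheme, an isomorphism over a
non-empty open of the normal integral scheme `X` (Stacks 0AY8, tree `TowardsNormal.isIso_app`).
[cite: StacksProject, Tag 0AY8 (More on Morphisms, Lemma 37.53.6)] -/
theorem isIso_app_of_isIso_morphismRestrict [IsIntegral Z] [Surjective ρ]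
    (hXn : ∀ x : X, IsIntegrallyClosed (X.presheaf.stalk x)) (O : X.Opens)
    (hO : (O : Set X).Nonempty) [IsIso (ρ ∣_ O)] (V : X.Opens) : IsIso (ρ.app V) := by
  haveI : Nonempty O := by
    obtain ⟨y, hy⟩ := hO
    exact ⟨⟨y, hy⟩⟩
  have hξO : genericPoint X ∈ O :=
    Literature.AlgebraicGeometry.Morphisms.TowardsNormal.genericPoint_mem X O
  have hgen : ∀ z ∈ genericPoints Z, ρ.base z = genericPoint X := by
    intro z hz
    rw [genericPoints_eq_singleton, Set.mem_singleton_iff] at hz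
    rw [hz]
    exact apply_genericPoint_eq ρ
  have hrange : Set.range (X.fromSpecResidueField (genericPoint X)) ⊆ Set.range O.ι := by
    rw [Scheme.range_fromSpecResidueField, Scheme.Opens.range_ι, Set.singleton_subset_iff]
    exact hξO
  haveI : IsIso (ρ.fiberToSpecResidueField (genericPoint X)) :=
    isIso_pullbackSnd_of_isIso_morphismRestrict ρ O (X.fromSpecResidueField (genericPoint X))
      (IsOpenImmersion.lift O.ι _ hrange) (IsOpenImmersion.lift_fac _ _ hrange).symm
  have hξ : IsIso (ρ.fiberToSpecResidueField (genericPoint X)).appTop :=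
    (inferInstance : IsIso ((ρ.fiberToSpecResidueField (genericPoint X)).app ⊤))
  exact Literature.AlgebraicGeometry.Morphisms.TowardsNormal.isIso_app ρ hXn hgen hξ V

omit [NoetherianSpace X] [NoetherianSpace Z] in
/-- **`ρ_*𝒪_Z = 𝒪_X`** for `ρ : Z → X` proper birational between integral schemes with `X` regular
(hence normal): `𝒪_X(V) → 𝒪_Z(ρ⁻¹V)` is an isomorphism for every open `V` (Stacks 0AY8,
`isIso_app_of_isIso_morphismRestrict`).
[cite: StacksProject, Tag 0AY8 (More on Morphisms, Lemma 37.53.6)] -/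
theorem isIso_app_of_isBirational_of_isRegular (hρ : IsBirational ρ) (hX : Scheme.IsRegular X)
    (V : X.Opens) : IsIso (ρ.app V) := by
  haveI : IsDominant ρ := hρ.isDominant
  obtain ⟨O, hO, -, hiso⟩ := hρ
  haveI := hiso
  exact isIso_app_of_isIso_morphismRestrict ρ
    (fun x => by haveI := hX x; exact isIntegrallyClosed_of_isRegularLocalRing _) O hO.nonempty V

omit [IsIntegral X] [IsIntegral Z] [NoetherianSpace X] [NoetherianSpace Z] [IsProper ρ] in
/-- With `ρ.app V` an isomorphism, the section pullback `𝒪_X(V) → 𝒪_Z(W)`, `W = ρ⁻¹V`, is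
bijective. [folklore] -/
theorem comap_bijective_of_isIso_app {V : X.Opens} {W : Z.Opens} (e : W ≤ ρ ⁻¹ᵁ V)
    (heq : W = ρ ⁻¹ᵁ V) [IsIso (ρ.app V)] :
    Function.Bijective (Sections.comap πX (ρ ≫ πX) ρ rfl e) := by
  subst heq
  rw [show (Sections.comap πX (ρ ≫ πX) ρ rfl e : _ → _) = (ρ.app V).hom from by
    funext s; rw [Sections.comap_apply, Scheme.Hom.appLE_eq_app]]
  exact ConcreteCategory.bijective_of_isIso (ρ.app V)

/-- **Leray in degree one along a domination of regular surfaces.** For `ρ : Z → X` proper birational,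
`Z` regular, `X` regular with local rings of dimension `≤ 2` (both integral, e.g. two resolutions of a
normal surface germ), a finite family `𝒰` of affine opens of `X` and a finite affine open cover `𝒲` of
`Z` refining `ρ⁻¹𝒰` via `τ` (the opens `ρ⁻¹U_i ∩ W_j` and their pairwise and triple intersections affine,
e.g. `Z` separated): the composite `Ȟ¹(𝒰, 𝒪_X) → Ȟ¹(ρ⁻¹𝒰, 𝒪_Z) → Ȟ¹(𝒲, 𝒪_Z)` is surjective
(`ρ_*𝒪_Z = 𝒪_X` and chartwise `R¹ρ_*𝒪_Z = 0`, mod Lipman (1.2)).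
[cite: GortzWedhorn2023, Cor. 21.82 (p. 265)] -/
theorem cechRefineH1_comp_cechComapH1_surjective (h12 : Lipman1969_1_2.{0}) (hρ : IsBirational ρ)
    (hZ : Scheme.IsRegular Z) (hX : Scheme.IsRegular X)
    (hdimX : ∀ x : X, ringKrullDim (X.presheaf.stalk x) ≤ 2)
    {ι : Type} [Finite ι] (U : ι → X.Opens) (hU : ∀ i, IsAffineOpen (U i))
    {κ : Type} [Finite κ] (W : κ → Z.Opens) (hWcov : ⨆ j, W j = ⊤) (τ : κ → ι)
    (hτ : ∀ j, W j ≤ ρ ⁻¹ᵁ U (τ j)) (hUW : ∀ i j, IsAffineOpen (ρ ⁻¹ᵁ U i ⊓ W j))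
    (hUW2 : ∀ i j j', IsAffineOpen (ρ ⁻¹ᵁ U i ⊓ W j ⊓ (ρ ⁻¹ᵁ U i ⊓ W j')))
    (hUW3 : ∀ i j j' j'',
      IsAffineOpen (ρ ⁻¹ᵁ U i ⊓ W j ⊓ (ρ ⁻¹ᵁ U i ⊓ W j') ⊓ (ρ ⁻¹ᵁ U i ⊓ W j''))) :
    Function.Surjective
      (cechRefineH1 (ρ ≫ πX) (preimageFamily ρ U) W τ hτ ∘ₗ cechComapH1 πX (ρ ≫ πX) ρ rfl U) := by
  rw [LinearMap.coe_comp]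
  refine Function.Surjective.comp ?_ ?_
  · refine cechRefineH1_surjective (ρ ≫ πX) (preimageFamily ρ U) W τ hτ (fun i => ?_) fun i => ?_
    · rw [hWcov]; exact le_top
    · exact cechZ1_le_cechB1_chart πX ρ h12 hρ hZ hX hdimX (hU i) (fun j => ρ ⁻¹ᵁ U i ⊓ W j)
        (by rw [← inf_iSup_eq, hWcov, inf_top_eq]) (hUW i) (hUW2 i) (hUW3 i)
  · haveI := fun V : X.Opens => isIso_app_of_isBirational_of_isRegular ρ hρ hX V
    exact cechComapH1_surjective_of_appLE_bijective πX (ρ ≫ πX) ρ rfl U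
      (fun i i' => comap_bijective_of_isIso_app πX ρ _ rfl)
      (fun i i' i'' => (comap_bijective_of_isIso_app πX ρ _ rfl).1)

/-- **The geometric genus does not grow under domination** (resolution-independence, monotone form):
in the situation of `cechRefineH1_comp_cechComapH1_surjective`, over any base ring `T`,
`length_T Ȟ¹(𝒲, 𝒪_Z) ≤ length_T Ȟ¹(𝒰, 𝒪_X)`. With `Ȟ¹ = H¹` for finite affine covers of separated
schemes this is `h¹(Z, 𝒪_Z) ≤ h¹(X, 𝒪_X)` for a resolution `Z` dominating the resolution `X`
(in fact equality, Leray; only `≤` is used by the genus descent).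
[cite: GortzWedhorn2023, Cor. 21.82 (p. 265)] -/
theorem length_cechH1_le_of_dominates (h12 : Lipman1969_1_2.{0}) (hρ : IsBirational ρ)
    (hZ : Scheme.IsRegular Z) (hX : Scheme.IsRegular X)
    (hdimX : ∀ x : X, ringKrullDim (X.presheaf.stalk x) ≤ 2)
    {ι : Type} [Finite ι] (U : ι → X.Opens) (hU : ∀ i, IsAffineOpen (U i))
    {κ : Type} [Finite κ] (W : κ → Z.Opens) (hWcov : ⨆ j, W j = ⊤) (τ : κ → ι)
    (hτ : ∀ j, W j ≤ ρ ⁻¹ᵁ U (τ j)) (hUW : ∀ i j, IsAffineOpen (ρ ⁻¹ᵁ U i ⊓ W j))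
    (hUW2 : ∀ i j j', IsAffineOpen (ρ ⁻¹ᵁ U i ⊓ W j ⊓ (ρ ⁻¹ᵁ U i ⊓ W j')))
    (hUW3 : ∀ i j j' j'',
      IsAffineOpen (ρ ⁻¹ᵁ U i ⊓ W j ⊓ (ρ ⁻¹ᵁ U i ⊓ W j') ⊓ (ρ ⁻¹ᵁ U i ⊓ W j''))) :
    Module.length T (CechH1 (ρ ≫ πX) W) ≤ Module.length T (CechH1 πX U) :=
  Module.length_le_of_surjective _ (cechRefineH1_comp_cechComapH1_surjective πX ρ h12 hρ hZ hX
    hdimX U hU W hWcov τ hτ hUW hUW2 hUW3)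

end Domination

end Summit.ResolutionOfSingularities.ResolutionOfSingularities.Theorems.SurfaceTermination.GenusDescent

end
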